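import Summits.ResolutionOfSingularities.ResolutionOfSingularities.Theorems.WeightedInvariantIota3TauEssSmoothOfDescent
import Summits.ResolutionOfSingularities.ResolutionOfSingularities.Theorems.WeightedInvariantJFlatEssSmoothAssembly
import Summits.ResolutionOfSingularities.ResolutionOfSingularities.Theorems.WeightedInvariantIotaCylinderUpperSemicontinuousOnLE
import HarnessLib

/-!
# THE GAP hc11 OF THE P3 RUNG ⟸ (desc-τ) ∧ the pointwise σ-compatibility ∧ the point branch of `jFlatT_map`
# (door `HypersurfaceCentreConstruction`, stmt-ResolutionOfSingularities-19897; registered stub `stub_keyRungGrHomLE_three`, gap hc11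
# `IotaJEssSmoothCompatibleLE 3 Iota3.iotaFlatT Iota3.jFlatT`)

Topic: `Summits/ResolutionOfSingularities/ResolutionOfSingularities/Theorems`. Helper for the door item `HypersurfaceCentreConstruction`
(stmt-ResolutionOfSingularities-19897, route `WeightedInvariant`), line `local-engine`, def-free.  (c11)≤3 for the pair of record
`(ι₃ᵗ, J₃ᵗ) = (iotaFlatT, jFlatT)` — `ι₃ᵗ(S', φ f) = ι₃ᵗ(S, f)` and `J₃ᵗ(S', φ f)ₘ = J₃ᵗ(S, f)ₘ S'` along local formally smooth
essentially-of-finite-type `φ : S → S'` of regular local rings with `dim S' ≤ 3` — from THREE named inputs: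
* (desc-τ) the descent of tie positions (the remaining half of (c11τ)≤3 after …Iota3TauEssSmoothAscent / …OfDescent), which gives `hτ` at the
  closed point and `hτpt` at every prime of `S'` (localised instance block of `ContactCylinder.iotaOrd_atPrime_eq_iotaOrd_atPrime_comap`);
* (σ-pt) the pointwise compatibility of the letter `σ`: `σ(S'_{𝔮'}, f) = σ(S_{𝔮' ∩ S}, f)` for every prime `𝔮'` of `S'` (the level half is open:
  memo O53-DESC-CEX; the ratio half is …Iota3SigmaRatioEssSmooth);
* (hpt) the equal-dimension-three point branch of `JFlatEssSmooth.jFlatT_map` (GAP 1 `jContact` / GAP 2 `jSigmaPt`).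
The ι-half: `ι₀` by `JFlatEssSmooth.iotaOrdEpsTau_map_eq_of_iotaTau`; the cylinder reads `σ` at the generic prime `P` of the top `ι₀`-stratum
(`Iota3.exists_topStratum_iotaOrdEpsTau_eq`: a prime, possibly `⊥`) and at `P S'` (`JFlatEssSmooth.topStratum_iotaOrdEpsTau_map_of_eq`, with
`P S'` prime: `⊥`, or regular quotient), and `(P S') ∩ S = P` by faithful flatness.  The J-half is `JFlatEssSmooth.jFlatT_map` verbatim.

* **`iotaJEssSmoothCompatibleLE_three_of_descent`** — `IotaJEssSmoothCompatibleLE 3 iotaFlatT jFlatT` ⟸ (desc-τ) ∧ (σ-pt) ∧ (hpt).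

[OURS · L1 W4.3 · hc11 audit glue]  Replaces the role of NO printed item; NOT a statement of the manuscript under review [claim: Hironaka2017,
status: under-review]; candidates stay candidates; AI work, weaker than expert review.  No definition; no axiom; the three inputs are hypotheses.
-/

noncomputable section

set_option linter.dupNamespace false -- mandated namespace `Summit.<Summit>.<Problem>` of this single-conjunct summit

open IsLocalRing Literature.AlgebraicGeometry.Resolution
open Summit.ResolutionOfSingularities.ResolutionOfSingularities.Theorems
open Summit.ResolutionOfSingularities.ResolutionOfSingularities.Theorems.ContactCylinder

namespace Summit.ResolutionOfSingularities.ResolutionOfSingularities.Cruxes.HypersurfaceCentreConstruction.LocalEngine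

namespace Iota3

section Hc11

variable
  (hD : ∀ (T T' : Type) [CommRing T] [IsRegularLocalRing T] [CommRing T'] [IsRegularLocalRing T'] [Algebra T T']
    [IsLocalHom (algebraMap T T')] [Algebra.FormallySmooth T T'] [Algebra.EssFiniteType T T'] (g : T),
    ringKrullDim T' ≤ 3 → IsTiePosition T' (algebraMap T T' g) → IsTiePosition T g)

section Pointwise

variable (S S' : Type) [CommRing S] [IsRegularLocalRing S] [CommRing S'] [IsRegularLocalRing S'] [Algebra S S']
  [Algebra.FormallySmooth S S'] [Algebra.EssFiniteType S S']

include hD in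
/-- **`hτpt` FROM (desc-τ)**: `τ(S'_{𝔮'}, f) = τ(S_{𝔮' ∩ S}, f)` at every prime `𝔮'` of `S'` with `dim S' ≤ 3` (the localised homomorphism
`S_{𝔮' ∩ S} → S'_{𝔮'}` is local, formally smooth, essentially of finite type between regular local rings of dimension `≤ 3`). [OURS] -/
theorem iotaTau_atPrime_eq_of_descent (hdimS' : ringKrullDim S' ≤ 3) (f : S) (𝔮' : Ideal S') [𝔮'.IsPrime] :
    iotaTau (Localization.AtPrime 𝔮') (algebraMap S (Localization.AtPrime 𝔮') f) =
      iotaTau (Localization.AtPrime (𝔮'.comap (algebraMap S S')))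
        (algebraMap S (Localization.AtPrime (𝔮'.comap (algebraMap S S'))) f) := by
  haveI : IsRegularLocalRing (Localization.AtPrime 𝔮') := isRegularLocalRing_localization_atPrime S' 𝔮'
  haveI : IsRegularLocalRing (Localization.AtPrime (𝔮'.comap (algebraMap S S'))) :=
    isRegularLocalRing_localization_atPrime S _
  letI : Algebra (Localization.AtPrime (𝔮'.comap (algebraMap S S'))) (Localization.AtPrime 𝔮') :=
    (Localization.localRingHom (𝔮'.comap (algebraMap S S')) 𝔮' (algebraMap S S') rfl).toAlgebra
  haveI : IsScalarTower S (Localization.AtPrime (𝔮'.comap (algebraMap S S'))) (Localization.AtPrime 𝔮') :=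
    IsScalarTower.of_algebraMap_eq fun s => by
      change _ = Localization.localRingHom (𝔮'.comap (algebraMap S S')) 𝔮' (algebraMap S S') rfl (algebraMap S _ s)
      rw [Localization.localRingHom_to_map, IsScalarTower.algebraMap_apply S S' (Localization.AtPrime 𝔮')]
  haveI : IsLocalHom (algebraMap (Localization.AtPrime (𝔮'.comap (algebraMap S S'))) (Localization.AtPrime 𝔮')) :=
    Localization.isLocalHom_localRingHom _ 𝔮' (algebraMap S S') rfl
  haveI : Algebra.FormallySmooth S (Localization.AtPrime 𝔮') := Algebra.FormallySmooth.comp S S' _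
  haveI : Algebra.EssFiniteType S (Localization.AtPrime 𝔮') := Algebra.EssFiniteType.comp S S' _
  haveI : Algebra.FormallySmooth (Localization.AtPrime (𝔮'.comap (algebraMap S S'))) (Localization.AtPrime 𝔮') :=
    Algebra.FormallySmooth.localization_base (𝔮'.comap (algebraMap S S')).primeCompl
  haveI : Algebra.EssFiniteType (Localization.AtPrime (𝔮'.comap (algebraMap S S'))) (Localization.AtPrime 𝔮') :=
    Algebra.EssFiniteType.of_comp S _ _
  have hdim𝔮' : ringKrullDim (Localization.AtPrime 𝔮') ≤ 3 := (ringKrullDim_localization_atPrime_le 𝔮').trans hdimS'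
  rw [IsScalarTower.algebraMap_apply S (Localization.AtPrime (𝔮'.comap (algebraMap S S'))) (Localization.AtPrime 𝔮') f]
  exact iotaTau_essSmooth_eq_of_descent hD _ _ _ hdim𝔮'

end Pointwise

include hD in
/-- **THE GAP hc11 OF THE P3 RUNG FROM (desc-τ), (σ-pt) AND (hpt)**: `IotaJEssSmoothCompatibleLE 3 Iota3.iotaFlatT Iota3.jFlatT`.
See the module docstring. [OURS · hc11 ⟸ (desc-τ) ∧ (σ-pt) ∧ (hpt)] -/
theorem iotaJEssSmoothCompatibleLE_three_of_descent
    (hσ : ∀ (T T' : Type) [CommRing T] [IsRegularLocalRing T] [CommRing T'] [IsRegularLocalRing T'] [Algebra T T']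
      [IsLocalHom (algebraMap T T')] [Algebra.FormallySmooth T T'] [Algebra.EssFiniteType T T'] (g : T) (𝔮' : Ideal T')
      [𝔮'.IsPrime], ringKrullDim T' ≤ 3 →
      iotaSigma (Localization.AtPrime 𝔮') (algebraMap T (Localization.AtPrime 𝔮') g) =
        iotaSigma (Localization.AtPrime (𝔮'.comap (algebraMap T T')))
          (algebraMap T (Localization.AtPrime (𝔮'.comap (algebraMap T T'))) g))
    (hpt : ∀ (T T' : Type) [CommRing T] [IsRegularLocalRing T] [CommRing T'] [IsRegularLocalRing T'] [Algebra T T']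
      [IsLocalHom (algebraMap T T')] [Algebra.FormallySmooth T T'] [Algebra.EssFiniteType T T'] (g : T),
      ringKrullDim T' ≤ 3 → (maximalIdeal T).map (algebraMap T T') = maximalIdeal T' → ringKrullDim T = (3 : ℕ) →
      ∀ m : ℕ, jFlatCoreE T' (algebraMap T T' g) m = (jFlatCoreE T g m).map (algebraMap T T')) :
    IotaJEssSmoothCompatibleLE 3 iotaFlatT jFlatT := by
  intro S S' _ _ _ _ _ _ _ _ f hdimS'
  classical
  haveI := isDomain_of_isRegularLocalRing S
  haveI := isDomain_of_isRegularLocalRing S'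
  haveI : Module.Flat S S' := IotaOrderEssSmooth.flat_of_formallySmooth_of_essFiniteType S S'
  haveI : Module.FaithfullyFlat S S' := Module.FaithfullyFlat.of_flat_of_isLocalHom
  have hτ : iotaTau S' (algebraMap S S' f) = iotaTau S f := iotaTau_essSmooth_eq_of_descent hD S S' f hdimS'
  have hτpt : ∀ (𝔮' : Ideal S') [𝔮'.IsPrime], iotaTau (Localization.AtPrime 𝔮') (algebraMap S (Localization.AtPrime 𝔮') f) =
      iotaTau (Localization.AtPrime (𝔮'.comap (algebraMap S S')))
        (algebraMap S (Localization.AtPrime (𝔮'.comap (algebraMap S S'))) f) :=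
    fun 𝔮' _ => iotaTau_atPrime_eq_of_descent hD S S' hdimS' f 𝔮'
  refine ⟨?_, fun m => JFlatEssSmooth.jFlatT_map S S' hdimS' f hτ hτpt (hpt S S' f hdimS') m⟩
  -- dimensions: `dim S ≤ dim S' ≤ 3`
  obtain ⟨a, b, c, ha, hb, -, hab⟩ := EssSmoothLE2.exists_dims S S'
  have hdimS : ringKrullDim S ≤ 3 := by
    have h : ((b : ℕ) : WithBot ℕ∞) ≤ 3 := hb ▸ hdimS'
    have hb3 : b ≤ 3 := by exact_mod_cast h
    rw [ha]; exact_mod_cast (show a ≤ 3 by omega)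
  -- the generic prime `P` of the top `ι₀`-stratum of `S`, with `P S'` prime
  have hP : ∃ (P : Ideal S) (_ : P.IsPrime) (_ : (P.map (algebraMap S S')).IsPrime),
      topStratum iotaOrdEpsTau S f = {𝔮 | P ≤ 𝔮.asIdeal} := by
    by_cases hf0 : f = 0
    · refine ⟨⊥, Ideal.isPrime_bot, by rw [Ideal.map_bot]; exact Ideal.isPrime_bot, ?_⟩
      subst hf0; exact topStratum_iotaOrdEpsTau_zero_eq_bot S hdimS
    by_cases hfu : IsUnit f
    · exact ⟨⊥, Ideal.isPrime_bot, by rw [Ideal.map_bot]; exact Ideal.isPrime_bot, topStratum_iotaOrdEpsTau_of_isUnit_eq_bot S hdimS hfu⟩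
    · have hf : f ∈ maximalIdeal S := (IsLocalRing.mem_maximalIdeal f).mpr (mem_nonunits_iff.mpr hfu)
      obtain ⟨P, hPp, hreg, -, hE⟩ := topStratum_iotaOrdEpsTau_eq hdimS hf0 hf
      haveI := hPp
      exact ⟨P, hPp, isPrime_map_of_isRegularLocalRing_quotient S S' P hreg, hE⟩
  obtain ⟨P, hPp, hP'p, hE⟩ := hP
  have hE' := JFlatEssSmooth.topStratum_iotaOrdEpsTau_map_of_eq S S' f hτ hτpt hE
  have hcomap : (P.map (algebraMap S S')).comap (algebraMap S S') = P := Ideal.comap_map_eq_self_of_faithfullyFlat (B := S') P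
  -- the invariant: `ι₀` and the cylinder
  rw [iotaFlatT_eq_iff]
  refine ⟨JFlatEssSmooth.iotaOrdEpsTau_map_eq_of_iotaTau S S' f hτ, ?_⟩
  rw [iotaCylinder_eq_of_topStratum_eq iotaOrdEpsTau iotaSigma _ _ hE', iotaCylinder_eq_of_topStratum_eq iotaOrdEpsTau iotaSigma _ _ hE,
    ← IsScalarTower.algebraMap_apply S S' (Localization.AtPrime (P.map (algebraMap S S'))) f,
    hσ S S' f (P.map (algebraMap S S')) hdimS']
  exact StratumIff.iota_localization_congr iotaSigma hcomap f

end Hc11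

end Iota3

end Summit.ResolutionOfSingularities.ResolutionOfSingularities.Cruxes.HypersurfaceCentreConstruction.LocalEngine

end
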